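import Mathlib.MeasureTheory.Measure.Portmanteau
import Literature.Probability.RandomPlanarGeometry.CurveSpace
import Summits.CriticalPhenomena.SAWScalingLimit.Theses.SAWRenewalTightness
import Summits.CriticalPhenomena.SAWScalingLimit.Theorems.SubseqIdentification.Negative.Necessity
import Summits.CriticalPhenomena.SAWScalingLimit.Theorems.SubseqIdentification.Negative.ProbabilityRedundant

/-!
# `stub_areaLawOfLimit`: the continuum two-sided `r²` boundary area law of a subsequential limit

Stub S5 (limit passage) of the registered skeleton of the line `boundary-area-law` for the crux
`SubseqIdentification` (stmt-CriticalPhenomena-0783, route `SAWRenewalTightness`; primary decl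
`SAWParafermion.SubseqIdentification`).

If the critical `δℤ²` SAW laws of a Dobrushin domain `(D; a, b)`, pushed to `CurveClass ℂ` by
`γ ↦ γ.curve`, converge weakly (test-function form) to a probability measure `μ` along a mesh
sequence `s`, the lattice ratio law holds along the sequence (for every fixed `0 < r ≤ ε₀`,
eventually in `n`, cross-multiplied against the reference radius `ε₀` in `ℝ≥0∞`), and `μ` is
non-degenerate at `x₀` (`μ[dist(x₀, trace) < ε] > 0` for all `ε > 0`), then
`c r² ≤ μ[dist ≤ r]` and `μ[dist < r] ≤ C' r²` for `0 < r < r₀ := ε₀`.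

Proof: the laws are probability measures eventually along the sequence
(`Negative.eventually_isProbabilityMeasure_of_tendsto`, from the `f ≡ 1` test integral); past that
index the image laws `ν n` are `ProbabilityMeasure`s converging to `μ`
(`ProbabilityMeasure.tendsto_iff_forall_integral_tendsto`, `integral_map`). The functional
`c ↦ dist(x₀, trace c)` is `1`-Lipschitz on `CurveClass ℂ` (`Curve.infDist_range_le`), so
`{dist ≤ r}` is closed and `{dist < r}` is open, and the portmanteau inequalities
(`ProbabilityMeasure.limsup_measure_closed_le_of_tendsto`,
`ProbabilityMeasure.le_liminf_measure_open_of_tendsto`) give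
UPPER `μ(< r) ≤ liminf ν_n(< r) ≤ liminf ν_n(≤ r) ≤ C (r/ε₀)² · 1` and
LOWER `μ(≤ r) ≥ limsup ν_n(≤ r) ≥ liminf ν_n(≤ r)` with, eventually,
`ν_n(≤ r) · C ε₀² ≥ ν_n(≤ ε₀) r² ≥ ν_n(< ε₀) r² > (μ(< ε₀)/2) r²`
(`eventually_lt_of_lt_liminf` on `μ(< ε₀) ≤ liminf ν_n(< ε₀)`), so `c = μ(< ε₀)/(2 C ε₀²)`.

No named fact is used; axioms `propext`, `Classical.choice`, `Quot.sound`.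
-/

noncomputable section

open MeasureTheory Filter Topology Set
open scoped NNReal ENNReal BoundedContinuousFunction

namespace Summit.CriticalPhenomena.SAWScalingLimit.Theorems.SubseqIdentification.BoundaryAreaLaw

open Literature.Probability.RandomPlanarGeometry Literature.Probability.LatticeModels

/-- `c ↦ dist(x₀, trace c)` is `1`-Lipschitz for the reparametrisation distance on curve classes:
every point of one trace is within `dist c₁ c₂` of the other trace (`Curve.infDist_range_le`).
[folklore] -/
private theorem lipschitzWith_infDist_range (z : ℂ) :
    LipschitzWith 1 fun c : CurveClass ℂ => Metric.infDist z c.range := by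
  -- adapted from `Literature.Barriers.CriticalPhenomena.SupercriticalSAW.lipschitzWith_infDist_range`
  refine LipschitzWith.of_le_add fun c₁ c₂ => ?_
  obtain ⟨γ₁, rfl⟩ := CurveClass.surjective_mk c₁
  obtain ⟨γ₂, rfl⟩ := CurveClass.surjective_mk c₂
  simp only [CurveClass.range_mk, CurveClass.dist_mk_mk]
  have key : ∀ ⦃y⦄, y ∈ γ₂.range → Metric.infDist z γ₁.range - dist γ₁ γ₂ ≤ dist z y := by
    rintro y ⟨t, rfl⟩
    have h₁ := Curve.infDist_range_le γ₂ γ₁ t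
    have h₂ := Metric.infDist_le_infDist_add_dist (s := γ₁.range) (x := z) (y := γ₂ t)
    rw [dist_comm γ₂ γ₁] at h₁
    linarith
  have h := (Metric.le_infDist γ₂.range_nonempty).2 key
  linarith

/-- **S5 — AREA LAW OF THE LIMIT (limit passage).**
If the pushed SAW laws converge weakly to a probability measure `μ` along `s → 0⁺`, the lattice
ratio law holds along the sequence (cross-multiplied against the reference radius `ε₀`, for every
fixed `0 < r ≤ ε₀` eventually in `n`), and `μ` is non-degenerate at `x₀`
(`μ[dist(x₀, trace) < ε] > 0` for every `ε > 0`), then `μ` satisfies the CONTINUUM two-sided area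
law `c r² ≤ μ[dist ≤ r]`, `μ[dist < r] ≤ C' r²` for `0 < r < r₀`. Portmanteau on the Polish
`CurveClass ℂ`: `{dist ≤ r}` is closed and `{dist < r}` is open for the `1`-Lipschitz functional
`c ↦ dist(x₀, trace c)`; `r₀ = ε₀`, `C' = C/ε₀²`, `c = μ(< ε₀)/(2 C ε₀²)`. [folklore] -/
theorem stub_areaLawOfLimit :
    ∀ (D : DobrushinDomain) (a b : ℝ → Site 2) (s : ℕ → ℝ) (μ : Measure (CurveClass ℂ)) (x₀ : ℂ),
      Tendsto s atTop (𝓝[>] (0 : ℝ)) → IsProbabilityMeasure μ →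
      (∀ f : CurveClass ℂ →ᵇ ℝ,
        Tendsto (fun n => ∫ γ, f γ.curve ∂(SAW.law D.carrier (s n) (a (s n)) (b (s n))))
          atTop (𝓝 (∫ x, f x ∂μ))) →
      (∃ C ε₀ : ℝ, 0 < C ∧ 0 < ε₀ ∧ ∀ r : ℝ, 0 < r → r ≤ ε₀ → ∀ᶠ n in atTop,
          SAW.law D.carrier (s n) (a (s n)) (b (s n)) {γ | Metric.infDist x₀ γ.curve.range ≤ r} *
                ENNReal.ofReal (ε₀ ^ 2) ≤
              ENNReal.ofReal C *
                SAW.law D.carrier (s n) (a (s n)) (b (s n))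
                    {γ | Metric.infDist x₀ γ.curve.range ≤ ε₀} *
                  ENNReal.ofReal (r ^ 2) ∧
            SAW.law D.carrier (s n) (a (s n)) (b (s n)) {γ | Metric.infDist x₀ γ.curve.range ≤ ε₀} *
                ENNReal.ofReal (r ^ 2) ≤
              ENNReal.ofReal C *
                SAW.law D.carrier (s n) (a (s n)) (b (s n))
                    {γ | Metric.infDist x₀ γ.curve.range ≤ r} *
                  ENNReal.ofReal (ε₀ ^ 2)) →
      (∀ ε : ℝ, 0 < ε → 0 < μ {γ | Metric.infDist x₀ γ.range < ε}) →
      ∃ c C r₀ : ℝ, 0 < c ∧ 0 < r₀ ∧ ∀ r ∈ Set.Ioo (0 : ℝ) r₀,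
        ENNReal.ofReal (c * r ^ 2) ≤ μ {γ | Metric.infDist x₀ γ.range ≤ r} ∧
          μ {γ | Metric.infDist x₀ γ.range < r} ≤ ENNReal.ofReal (C * r ^ 2) := by
  intro D a b s μ x₀ _ hμ hlim hlaw hnd
  obtain ⟨C, ε₀, hC, hε₀, hlaw⟩ := hlaw
  haveI := hμ
  -- past some index `N` the SAW laws are probability measures (test integral of `f ≡ 1`)
  obtain ⟨N, hN⟩ := eventually_atTop.1
    (Negative.eventually_isProbabilityMeasure_of_tendsto (hlim 1))
  have hN' : ∀ n, IsProbabilityMeasure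
      (SAW.law D.carrier (s (n + N)) (a (s (n + N))) (b (s (n + N)))) :=
    fun n => hN _ (N.le_add_left n)
  -- the image probability measures on `CurveClass ℂ`
  let ν : ℕ → ProbabilityMeasure (CurveClass ℂ) := fun n =>
    ⟨(SAW.law D.carrier (s (n + N)) (a (s (n + N))) (b (s (n + N)))).map (fun γ => γ.curve),
      Measure.isProbabilityMeasure_map (SAW.DomainSAW.measurable_of_top _).aemeasurable⟩
  have hνapply : ∀ (n : ℕ) {S : Set (CurveClass ℂ)}, MeasurableSet S →
      ((ν n : ProbabilityMeasure (CurveClass ℂ)) : Measure (CurveClass ℂ)) S =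
        SAW.law D.carrier (s (n + N)) (a (s (n + N))) (b (s (n + N)))
          ((fun γ => γ.curve) ⁻¹' S) :=
    fun n S hS => Measure.map_apply (SAW.DomainSAW.measurable_of_top _) hS
  -- weak convergence of the image probability measures
  have hνlim : Tendsto ν atTop (𝓝 (⟨μ, hμ⟩ : ProbabilityMeasure (CurveClass ℂ))) := by
    refine ProbabilityMeasure.tendsto_iff_forall_integral_tendsto.2 fun f => ?_
    have h := (hlim f).comp (tendsto_add_atTop_nat N)
    refine h.congr fun n => ?_
    change ∫ γ, f γ.curve ∂(SAW.law D.carrier (s (n + N)) (a (s (n + N))) (b (s (n + N)))) =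
      ∫ x, f x ∂((SAW.law D.carrier (s (n + N)) (a (s (n + N))) (b (s (n + N)))).map
        (fun γ => γ.curve))
    exact (integral_map (SAW.DomainSAW.measurable_of_top _).aemeasurable
      f.continuous.aestronglyMeasurable).symm
  -- the events: `{dist ≤ r}` is closed, `{dist < r}` is open
  have hcont : Continuous fun c : CurveClass ℂ => Metric.infDist x₀ c.range :=
    (lipschitzWith_infDist_range x₀).continuous
  have hclosed : ∀ r : ℝ, IsClosed {c : CurveClass ℂ | Metric.infDist x₀ c.range ≤ r} :=
    fun r => isClosed_le hcont continuous_const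
  have hopen : ∀ r : ℝ, IsOpen {c : CurveClass ℂ | Metric.infDist x₀ c.range < r} :=
    fun r => isOpen_lt hcont continuous_const
  -- portmanteau
  have hlimsup : ∀ r : ℝ,
      limsup (fun n => ((ν n : ProbabilityMeasure (CurveClass ℂ)) : Measure (CurveClass ℂ))
        {c | Metric.infDist x₀ c.range ≤ r}) atTop ≤ μ {c | Metric.infDist x₀ c.range ≤ r} :=
    fun r => ProbabilityMeasure.limsup_measure_closed_le_of_tendsto hνlim (hclosed r)
  have hliminf : ∀ r : ℝ, μ {c | Metric.infDist x₀ c.range < r} ≤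
      liminf (fun n => ((ν n : ProbabilityMeasure (CurveClass ℂ)) : Measure (CurveClass ℂ))
        {c | Metric.infDist x₀ c.range < r}) atTop :=
    fun r => ProbabilityMeasure.le_liminf_measure_open_of_tendsto hνlim (hopen r)
  -- the image measures of the two events are the lattice probabilities
  have hνle : ∀ (n : ℕ) (r : ℝ),
      ((ν n : ProbabilityMeasure (CurveClass ℂ)) : Measure (CurveClass ℂ))
          {c | Metric.infDist x₀ c.range ≤ r} =
        SAW.law D.carrier (s (n + N)) (a (s (n + N))) (b (s (n + N)))
          {γ | Metric.infDist x₀ γ.curve.range ≤ r} :=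
    fun n r => hνapply n (hclosed r).measurableSet
  have hνlt : ∀ (n : ℕ) (r : ℝ),
      ((ν n : ProbabilityMeasure (CurveClass ℂ)) : Measure (CurveClass ℂ))
          {c | Metric.infDist x₀ c.range < r} =
        SAW.law D.carrier (s (n + N)) (a (s (n + N))) (b (s (n + N)))
          {γ | Metric.infDist x₀ γ.curve.range < r} :=
    fun n r => hνapply n (hopen r).measurableSet
  -- non-degeneracy at the reference radius, and half of it as an eventual lower bound
  have hm₀ : 0 < μ {c | Metric.infDist x₀ c.range < ε₀} := hnd ε₀ hε₀
  have hm₀top : μ {c | Metric.infDist x₀ c.range < ε₀} ≠ ∞ := measure_ne_top μ _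
  set m' : ℝ≥0∞ := μ {c | Metric.infDist x₀ c.range < ε₀} / 2 with hm'
  have hm'lt : m' < μ {c | Metric.infDist x₀ c.range < ε₀} :=
    ENNReal.half_lt_self hm₀.ne' hm₀top
  have hm'pos : 0 < m' := ENNReal.half_pos hm₀.ne'
  have hm'top : m' ≠ ∞ := ne_top_of_lt hm'lt
  have hevm : ∀ᶠ n in atTop, m' < ((ν n : ProbabilityMeasure (CurveClass ℂ)) :
      Measure (CurveClass ℂ)) {c | Metric.infDist x₀ c.range < ε₀} :=
    eventually_lt_of_lt_liminf (hm'lt.trans_le (hliminf ε₀))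
  have hCε : 0 < C * ε₀ ^ 2 := by positivity
  refine ⟨m'.toReal / (C * ε₀ ^ 2), C / ε₀ ^ 2, ε₀,
    div_pos (ENNReal.toReal_pos hm'pos.ne' hm'top) hCε, hε₀, fun r hr => ?_⟩
  obtain ⟨hr0, hrε⟩ := hr
  -- the lattice ratio law at radius `r`, shifted to the index `n + N`
  have hev := (tendsto_add_atTop_nat N).eventually (hlaw r hr0 hrε.le)
  refine ⟨?_, ?_⟩
  · -- LOWER bound: `c r² ≤ liminf ν_n(≤ r) ≤ limsup ν_n(≤ r) ≤ μ(≤ r)`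
    refine le_trans ?_ (hlimsup r)
    refine le_trans ?_ liminf_le_limsup
    refine le_liminf_of_le (h := ?_)
    filter_upwards [hev, hevm] with n hn hmn
    obtain ⟨-, h2⟩ := hn
    rw [hνle n r]
    rw [hνlt n ε₀] at hmn
    have hmono : SAW.law D.carrier (s (n + N)) (a (s (n + N))) (b (s (n + N)))
          {γ | Metric.infDist x₀ γ.curve.range < ε₀} ≤
        SAW.law D.carrier (s (n + N)) (a (s (n + N))) (b (s (n + N)))
          {γ | Metric.infDist x₀ γ.curve.range ≤ ε₀} :=
      measure_mono fun γ (hγ : Metric.infDist x₀ γ.curve.range < ε₀) =>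
        show Metric.infDist x₀ γ.curve.range ≤ ε₀ from hγ.le
    have key : m' * ENNReal.ofReal (r ^ 2) ≤
        SAW.law D.carrier (s (n + N)) (a (s (n + N))) (b (s (n + N)))
            {γ | Metric.infDist x₀ γ.curve.range ≤ r} * ENNReal.ofReal (C * ε₀ ^ 2) :=
      calc m' * ENNReal.ofReal (r ^ 2)
          ≤ SAW.law D.carrier (s (n + N)) (a (s (n + N))) (b (s (n + N)))
              {γ | Metric.infDist x₀ γ.curve.range ≤ ε₀} * ENNReal.ofReal (r ^ 2) :=
            mul_le_mul_left (hmn.le.trans hmono) _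
        _ ≤ ENNReal.ofReal C *
              SAW.law D.carrier (s (n + N)) (a (s (n + N))) (b (s (n + N)))
                {γ | Metric.infDist x₀ γ.curve.range ≤ r} * ENNReal.ofReal (ε₀ ^ 2) := h2
        _ = SAW.law D.carrier (s (n + N)) (a (s (n + N))) (b (s (n + N)))
              {γ | Metric.infDist x₀ γ.curve.range ≤ r} * ENNReal.ofReal (C * ε₀ ^ 2) := by
            rw [ENNReal.ofReal_mul hC.le]; ring
    calc ENNReal.ofReal (m'.toReal / (C * ε₀ ^ 2) * r ^ 2)
        = m' * ENNReal.ofReal (r ^ 2) / ENNReal.ofReal (C * ε₀ ^ 2) := by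
          rw [div_mul_eq_mul_div, ENNReal.ofReal_div_of_pos hCε,
            ENNReal.ofReal_mul ENNReal.toReal_nonneg, ENNReal.ofReal_toReal hm'top]
      _ ≤ SAW.law D.carrier (s (n + N)) (a (s (n + N))) (b (s (n + N)))
            {γ | Metric.infDist x₀ γ.curve.range ≤ r} := ENNReal.div_le_of_le_mul key
  · -- UPPER bound: `μ(< r) ≤ liminf ν_n(< r) ≤ C (r/ε₀)²`
    refine (hliminf r).trans (liminf_le_of_frequently_le' (Eventually.frequently ?_))
    filter_upwards [hev] with n hn
    obtain ⟨h1, -⟩ := hn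
    rw [hνlt n r]
    have hε₀2 : ENNReal.ofReal (ε₀ ^ 2) ≠ 0 := (ENNReal.ofReal_pos.2 (by positivity)).ne'
    calc SAW.law D.carrier (s (n + N)) (a (s (n + N))) (b (s (n + N)))
          {γ | Metric.infDist x₀ γ.curve.range < r}
        ≤ SAW.law D.carrier (s (n + N)) (a (s (n + N))) (b (s (n + N)))
            {γ | Metric.infDist x₀ γ.curve.range ≤ r} :=
          measure_mono fun γ (hγ : Metric.infDist x₀ γ.curve.range < r) =>
            show Metric.infDist x₀ γ.curve.range ≤ r from hγ.le
      _ ≤ ENNReal.ofReal (C * r ^ 2) / ENNReal.ofReal (ε₀ ^ 2) := by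
          rw [ENNReal.le_div_iff_mul_le (Or.inl hε₀2) (Or.inl ENNReal.ofReal_ne_top)]
          calc SAW.law D.carrier (s (n + N)) (a (s (n + N))) (b (s (n + N)))
                  {γ | Metric.infDist x₀ γ.curve.range ≤ r} * ENNReal.ofReal (ε₀ ^ 2)
              ≤ ENNReal.ofReal C *
                  SAW.law D.carrier (s (n + N)) (a (s (n + N))) (b (s (n + N)))
                    {γ | Metric.infDist x₀ γ.curve.range ≤ ε₀} * ENNReal.ofReal (r ^ 2) := h1
            _ ≤ ENNReal.ofReal C * 1 * ENNReal.ofReal (r ^ 2) := by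
                gcongr
                exact prob_le_one
            _ = ENNReal.ofReal (C * r ^ 2) := by rw [mul_one, ENNReal.ofReal_mul hC.le]
      _ = ENNReal.ofReal (C / ε₀ ^ 2 * r ^ 2) := by
          rw [← ENNReal.ofReal_div_of_pos (by positivity)]
          congr 1
          ring

end Summit.CriticalPhenomena.SAWScalingLimit.Theorems.SubseqIdentification.BoundaryAreaLaw

end
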